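import Summits.QuantumFields.YangMills.Theorems.UnitScaleTiltProp7CovLinAvgStructureStep
import Summits.QuantumFields.YangMills.Theorems.UnitScaleTiltProp7CombMeanCentred
import Literature.MathematicalPhysics.QuantumFieldTheory.Balaban1983to89.LatticeWordStokes
import Literature.MathematicalPhysics.QuantumFieldTheory.Balaban1983to89.TorusGeometry
import HarnessLib

/-!
# Route `UnitScaleTilt`, crux K1 «MinimiserStabilityRegPr» (stmt-QuantumFields-19200), route-R [RP] at a curved background — THE CURVED N6,
# ROW (R-B) OF `CURVED-N6-LOCATED-w2g2.md`, PART 2: THE COVARIANT CENTRING OF THE COMB MEAN — the covariant comb mean of brick 1 kills FRAME-READ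
# direction constants, up to the oscillation of the field and the frame defect of the background's staircase transports (abstract reference frames),
# and the frame defect of the CANONICAL staircase frame by the tree's non-abelian Stokes bound

Cell `ym3-torus`, D-0154 (3c) R3 twin-width seat `ym-routeR-w2` (W-SEAT MAP pass #3 row M9: «(R-B) instantiation»), companion of
`UnitScaleTiltProp7CovIterLambdaBound` (propagation + tower junction).  THEOREMS ONLY (0 `def`, 0 `sorry`); `--supports stmt-QuantumFields-19200`,
count-neutral.  YM₃ on T³ is a ladder rung (R3), not the Clay problem; nothing here claims the curved N6 bound, S2, P, the crux or the gap.

WHY.  The per-level term of the curved structure theorem's coarse gauge function is the covariant comb mean `CM_j(G_j)(z) = |I|⁻¹Σ_i (G_j)_{V}(Γ^{σ_i}_{z→x_i})`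
(`V = Ū₀^{(j)}`, `covWalkSum` of `BlockAveragingEMLLinearisedBackground` along the staircases of [Balaban1987RG1] (0.3) from the centre `emb z`; brick 1
✓ p602235 `Prop7CovLinAvgStructureStep.norm_covLinAvgR0_sub_structure_le`).  Its `(H¹)^*`-bound goes, as in the flat N6-B (`Prop7CombMeanCentred`), through
«subtract direction constants, then Poincaré»: at a curved background the constants must be read in FRAMES (transports to the centre), and the comb's own
transports along different staircases differ from any fixed frame by loop holonomies — the frame defect.  This file isolates that step with the frames
ABSTRACT (`τ : T^{(j)} → SU(N)`), so that the Poincaré step may supply whichever frame it produces, and discharges the defect for the canonical frame.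
* §1 `norm_conj_covWalkSum_sub_netDisp_le` — along ONE walk: `‖W·X_V(walk x w)·W* − Σ_κ netDisp(w)_κ • m_κ‖ ≤ |w|·(o + 2θB)` under `‖X‖ ≤ B`,
  `‖τ(b₋)X(b)τ(b₋)* − m_{dir b}‖ ≤ o` on the walk's bonds and `‖W·V(walk x (w.take p))·τ(walkEnd x (w.take p))* − 1‖ ≤ θ` at every prefix (induction on the
  word; change of frame `‖WXW* − τXτ*‖ ≤ 2‖Wτ* − 1‖‖X‖`); ★ `norm_covCombMean_le_osc` — averaged over the comb: `‖CM^V(X)(z)‖ ≤ (d+2)L·(o + 2θB)`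
  (`Σ_r off r = 0`, `Prop7CombMeanCentred.sum_off_eq_zero`; staircases stay in `B(z)`, `ChartHInv.blockOf_of_mem_walk_stairWord`).
* §2 `frame_defect_stair_le` — for the canonical frame `τ_z(y) = V(Γ^{1}_{z→y})` (the `σ = 1` staircase to the integer offset `y − emb z`) and a background
  with plaquette variables within `a` of `1`: `θ ≤ ((dL)²/4)·a` (closed word of length `≤ d(L−1)`, `LatticeWordStokes.dist1_holAt_le`;
  `intOffset_walkEnd_take_stairWord`: no reduction modulo the period along a staircase prefix).

HONEST SCOPE.  Bookkeeping and the triangle inequality over the tree's (0.3)/(0.4) and (58) letters; the oscillation `o` (covariant Poincaré on `B(z)`)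
is the next file.  Nothing of Bałaban's analysis is asserted beyond the cited tree theorems.

References: T. Bałaban, CMP 98 (1985) 17–51 [Balaban1985Averaging] ((19)–(20) p.21, (58) p.27, (62) p.28); CMP 109 (1987) 249–301 [Balaban1987RG1] ((0.3)–(0.4) pp.252–253).
-/

noncomputable section

open scoped BigOperators Matrix.Norms.L2Operator

namespace Summit.QuantumFields.YangMills.Theorems.Prop7CovCombMeanCentred

open Literature.MathematicalPhysics.QuantumFieldTheory.Balaban1983to89
open Finset T4Continuum BlockAveraging AveragingRT BlockAveragingEMLLinearised BlockAveragingEMLLinearisedBackground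
open Summit.QuantumFields.YangMills.Theorems.Prop7CovLinAvgStructureStep (norm_conj_mul_sub_conj_le)
open Summit.QuantumFields.YangMills.Theorems.Prop7CombMeanCentred (sum_off_eq_zero)
open Summit.QuantumFields.YangMills.Theorems.ChartHInv (blockOf_of_mem_walk_stairWord)
open Summit.QuantumFields.YangMills.Theorems.Prop8Chart (norm_card_inv_smul_sum_le)

variable {P : Params}

/-! ## §1 Covariant centring: the covariant comb mean kills frame-read direction constants, up to the oscillation and the frame defect -/

section Centring

variable {n : Type*} [Fintype n] [DecidableEq n] [Nonempty n] {j : ℕ}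

omit [Nonempty n] in
/-- The inverse in `SU(N)` is the conjugate transpose (coercion). [folklore] -/
private theorem coe_inv_eq_star (g : Matrix.specialUnitaryGroup n ℂ) :
    ((g⁻¹ : Matrix.specialUnitaryGroup n ℂ) : Matrix n n ℂ) = star (g : Matrix n n ℂ) := rfl

/-- **CHANGE OF FRAME**: `‖W·X·W* − τ·X·τ*‖ ≤ 2‖W·τ* − 1‖·‖X‖` for special-unitary `W`, `τ`. [folklore] -/
theorem norm_conj_sub_conj_le_frame (W τ : Matrix.specialUnitaryGroup n ℂ) (X : Matrix n n ℂ) :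
    ‖(W : Matrix n n ℂ) * X * star (W : Matrix n n ℂ) - (τ : Matrix n n ℂ) * X * star (τ : Matrix n n ℂ)‖
      ≤ 2 * ‖(W : Matrix n n ℂ) * star (τ : Matrix n n ℂ) - 1‖ * ‖X‖ := by
  have h := norm_conj_mul_sub_conj_le (W * τ⁻¹) τ X
  rw [inv_mul_cancel_right] at h
  rwa [Submonoid.coe_mul, coe_inv_eq_star] at h

/-- **ONE STEP OF THE CENTRING**: replace the transport `W'` by the frame `τ(b₋)` (cost `2θ‖X b‖`), then the frame-read variable by the constant
(cost `o`). [cite: Balaban1985Averaging, (58) p.27 (bookkeeping)] -/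
theorem norm_conj_sub_const_le_of_frame (X : PBond P j → Matrix n n ℂ) (m : Fin P.d → Matrix n n ℂ) (τ : Site P j → Matrix.specialUnitaryGroup n ℂ)
    {o θ B : ℝ} (hθ : 0 ≤ θ) (W' : Matrix.specialUnitaryGroup n ℂ) (b : PBond P j) (hXb : ‖X b‖ ≤ B)
    (hob : ‖((τ b.src : Matrix.specialUnitaryGroup n ℂ) : Matrix n n ℂ) * X b * star ((τ b.src : Matrix.specialUnitaryGroup n ℂ) : Matrix n n ℂ) - m b.dir‖ ≤ o)
    (hfb : ‖((W' : Matrix.specialUnitaryGroup n ℂ) : Matrix n n ℂ) * star ((τ b.src : Matrix.specialUnitaryGroup n ℂ) : Matrix n n ℂ) - 1‖ ≤ θ) :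
    ‖((W' : Matrix.specialUnitaryGroup n ℂ) : Matrix n n ℂ) * X b * star ((W' : Matrix.specialUnitaryGroup n ℂ) : Matrix n n ℂ) - m b.dir‖ ≤ o + 2 * θ * B := by
  have hfr := norm_conj_sub_conj_le_frame W' (τ b.src) (X b)
  have h2 : 2 * ‖((W' : Matrix.specialUnitaryGroup n ℂ) : Matrix n n ℂ) * star ((τ b.src : Matrix.specialUnitaryGroup n ℂ) : Matrix n n ℂ) - 1‖ * ‖X b‖
      ≤ 2 * θ * B := by
    have := mul_le_mul hfb hXb (norm_nonneg _) hθ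
    linarith
  calc ‖((W' : Matrix.specialUnitaryGroup n ℂ) : Matrix n n ℂ) * X b * star ((W' : Matrix.specialUnitaryGroup n ℂ) : Matrix n n ℂ) - m b.dir‖
      ≤ ‖((W' : Matrix.specialUnitaryGroup n ℂ) : Matrix n n ℂ) * X b * star ((W' : Matrix.specialUnitaryGroup n ℂ) : Matrix n n ℂ)
            - ((τ b.src : Matrix.specialUnitaryGroup n ℂ) : Matrix n n ℂ) * X b * star ((τ b.src : Matrix.specialUnitaryGroup n ℂ) : Matrix n n ℂ)‖
        + ‖((τ b.src : Matrix.specialUnitaryGroup n ℂ) : Matrix n n ℂ) * X b * star ((τ b.src : Matrix.specialUnitaryGroup n ℂ) : Matrix n n ℂ) - m b.dir‖ :=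
        norm_sub_le_norm_sub_add_norm_sub _ _ _
    _ ≤ 2 * ‖((W' : Matrix.specialUnitaryGroup n ℂ) : Matrix n n ℂ) * star ((τ b.src : Matrix.specialUnitaryGroup n ℂ) : Matrix n n ℂ) - 1‖ * ‖X b‖ + o :=
        add_le_add hfr hob
    _ ≤ o + 2 * θ * B := by linarith

omit [Fintype n] [DecidableEq n] [Nonempty n] in
/-- Net displacement of a word with a forward letter in front, read through direction constants. [folklore] -/
theorem sum_netDisp_cons_true_smul (m : Fin P.d → Matrix n n ℂ) (μ : Fin P.d) (w : List (Letter P.d)) :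
    ∑ κ : Fin P.d, (netDisp ((μ, true) :: w) κ) • m κ = m μ + ∑ κ : Fin P.d, (netDisp w κ) • m κ := by
  simp only [netDisp_cons, ↓reduceIte, add_smul, Finset.sum_add_distrib, ite_smul, one_smul, zero_smul, Finset.sum_ite_eq, Finset.mem_univ]

omit [Fintype n] [DecidableEq n] [Nonempty n] in
/-- Net displacement of a word with a backward letter in front, read through direction constants. [folklore] -/
theorem sum_netDisp_cons_false_smul (m : Fin P.d → Matrix n n ℂ) (μ : Fin P.d) (w : List (Letter P.d)) :
    ∑ κ : Fin P.d, (netDisp ((μ, false) :: w) κ) • m κ = -m μ + ∑ κ : Fin P.d, (netDisp w κ) • m κ := by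
  simp only [netDisp_cons, Bool.false_eq_true, ↓reduceIte, add_smul, Finset.sum_add_distrib, ite_smul, neg_smul, one_smul, zero_smul,
    Finset.sum_ite_eq, Finset.mem_univ]

omit [Nonempty n] in
/-- Splitting the conjugated one-step recursion (forward step). [folklore] -/
theorem conj_step_split_fwd (W V C X₀ m₀ S : Matrix n n ℂ) :
    W * (X₀ + V * C * star V) * star W - (m₀ + S) = (W * X₀ * star W - m₀) + (W * V * C * (star V * star W) - S) := by
  noncomm_ring

omit [Nonempty n] in
/-- Splitting the conjugated one-step recursion (backward step). [folklore] -/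
theorem conj_step_split_bwd (W g C X₀ m₀ S : Matrix n n ℂ) :
    W * (-(g * X₀ * star g) + g * C * star g) * star W - (-m₀ + S) = -(W * g * X₀ * (star g * star W) - m₀) + (W * g * C * (star g * star W) - S) := by
  noncomm_ring

omit [Fintype n] [DecidableEq n] [Nonempty n] in
/-- The walk of a word with a forward letter in front. [folklore] -/
theorem walk_cons_true_eq (x : Site P j) (μ : Fin P.d) (w : List (Letter P.d)) :
    walk x ((μ, true) :: w) = ⟨⟨x, μ⟩, true⟩ :: walk (x.shift μ) w := by simp only [walk]

omit [Fintype n] [DecidableEq n] [Nonempty n] in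
/-- The walk of a word with a backward letter in front. [folklore] -/
theorem walk_cons_false_eq (x : Site P j) (μ : Fin P.d) (w : List (Letter P.d)) :
    walk x ((μ, false) :: w) = ⟨⟨x.unshift μ, μ⟩, false⟩ :: walk (x.unshift μ) w := by simp only [walk]

omit [Fintype n] [DecidableEq n] [Nonempty n] in
/-- The walk of a word with a forward letter in front, and of its prefixes. [folklore] -/
theorem walk_cons_true_take (x : Site P j) (μ : Fin P.d) (w : List (Letter P.d)) (p : ℕ) :
    walk x (((μ, true) :: w).take (p + 1)) = ⟨⟨x, μ⟩, true⟩ :: walk (x.shift μ) (w.take p) ∧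
      walkEnd x (((μ, true) :: w).take (p + 1)) = walkEnd (x.shift μ) (w.take p) := by
  simp only [List.take_succ_cons, walk, walkEnd, and_self]

omit [Fintype n] [DecidableEq n] [Nonempty n] in
/-- The walk of a word with a backward letter in front, and of its prefixes. [folklore] -/
theorem walk_cons_false_take (x : Site P j) (μ : Fin P.d) (w : List (Letter P.d)) (p : ℕ) :
    walk x (((μ, false) :: w).take (p + 1)) = ⟨⟨x.unshift μ, μ⟩, false⟩ :: walk (x.unshift μ) (w.take p) ∧
      walkEnd x (((μ, false) :: w).take (p + 1)) = walkEnd (x.unshift μ) (w.take p) := by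
  simp only [List.take_succ_cons, walk, walkEnd, and_self]

/-- **THE COVARIANT SIGNED SUM ALONG A WALK, CENTRED** — for ANY reference frames `τ : T^{(j)} → SU(N)` and direction constants `m`: if on the bonds of the
walk `‖X(b)‖ ≤ B` and the frame-read field oscillates by at most `o` around `m` (`‖τ(b₋)·X(b)·τ(b₋)* − m_{dir b}‖ ≤ o`), and the walk's own transports
(pre-multiplied by `W`) agree with the frames at every visited site up to `θ` (`‖W·V(walk x (w.take p))·τ(walkEnd x (w.take p))* − 1‖ ≤ θ`), then
`‖W·X_V(walk x w)·W* − Σ_κ netDisp(w)_κ • m_κ‖ ≤ |w|·(o + 2θB)` (each step contributes `±` its bond variable transported to the start along the walk,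
[Balaban1985Averaging] (58); the transport is replaced by the frame at cost `2θB`, the frame-read variable by `±m_{dir}` at cost `o`, and the `±m` sum to
the net displacement). [cite: Balaban1985Averaging, (58) p.27] -/
theorem norm_conj_covWalkSum_sub_netDisp_le (V : GaugeField P j (Matrix.specialUnitaryGroup n ℂ)) (X : PBond P j → Matrix n n ℂ)
    (m : Fin P.d → Matrix n n ℂ) (τ : Site P j → Matrix.specialUnitaryGroup n ℂ) {o θ B : ℝ} (hθ : 0 ≤ θ) :
    ∀ (w : List (Letter P.d)) (x : Site P j) (W : Matrix.specialUnitaryGroup n ℂ),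
      (∀ s ∈ walk x w, ‖X s.bond‖ ≤ B) →
      (∀ s ∈ walk x w, ‖((τ s.bond.src : Matrix.specialUnitaryGroup n ℂ) : Matrix n n ℂ) * X s.bond *
          star ((τ s.bond.src : Matrix.specialUnitaryGroup n ℂ) : Matrix n n ℂ) - m s.bond.dir‖ ≤ o) →
      (∀ p ≤ w.length, ‖((W * holAt V (walk x (w.take p)) : Matrix.specialUnitaryGroup n ℂ) : Matrix n n ℂ) *
          star ((τ (walkEnd x (w.take p)) : Matrix.specialUnitaryGroup n ℂ) : Matrix n n ℂ) - 1‖ ≤ θ) →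
      ‖(W : Matrix n n ℂ) * covWalkSum V X (walk x w) * star (W : Matrix n n ℂ) - ∑ κ : Fin P.d, (netDisp w κ) • m κ‖
        ≤ w.length * (o + 2 * θ * B) := by
  intro w
  induction w with
  | nil =>
    intro x W _ _ _
    simp [walk, netDisp]
  | cons l w ih =>
    intro x W hBw hosc hframe
    obtain ⟨μ, fb⟩ := l
    cases fb with
    | true =>
      -- the first step: the bond `⟨x, μ⟩` forward
      rw [walk_cons_true_eq] at hBw hosc
      rw [walk_cons_true_eq, covWalkSum_cons, List.length_cons, sum_netDisp_cons_true_smul]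
      have hstep : covStep V X ⟨⟨x, μ⟩, true⟩ = X ⟨x, μ⟩ := by simp only [covStep, ↓reduceIte]
      have hsf : stepFactor V ⟨⟨x, μ⟩, true⟩ = ((V ⟨x, μ⟩ : Matrix.specialUnitaryGroup n ℂ) : Matrix n n ℂ) := by
        simp only [stepFactor, ↓reduceIte]
      rw [hstep, hsf, conj_step_split_fwd]
      -- the frame at `x` (prefix `p = 0`)
      have hf0 := hframe 0 (Nat.zero_le _)
      rw [List.take_zero] at hf0
      have hw0 : walk x ([] : List (Letter P.d)) = [] := rfl
      have he0 : walkEnd x ([] : List (Letter P.d)) = x := rfl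
      rw [hw0, he0, holAt_nil, mul_one] at hf0
      have h1 := norm_conj_sub_const_le_of_frame X m τ hθ W ⟨x, μ⟩ (hBw ⟨⟨x, μ⟩, true⟩ List.mem_cons_self)
        (hosc ⟨⟨x, μ⟩, true⟩ List.mem_cons_self) hf0
      -- the tail, transported by `W·V(⟨x, μ⟩)`
      have h2 := ih (x.shift μ) (W * V ⟨x, μ⟩)
        (fun s hs => hBw s (List.mem_cons_of_mem _ hs)) (fun s hs => hosc s (List.mem_cons_of_mem _ hs))
        (fun p hp => by
          have h := hframe (p + 1) (Nat.succ_le_succ hp)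
          rw [(walk_cons_true_take x μ w p).1, (walk_cons_true_take x μ w p).2, holAt_cons] at h
          simpa only [↓reduceIte, mul_assoc] using h)
      rw [Submonoid.coe_mul, star_mul] at h2
      refine (norm_add_le _ _).trans ?_
      push_cast
      linarith [h1, h2]
    | false =>
      -- the first step: the bond `b = ⟨x − e_μ, μ⟩` backward
      rw [walk_cons_false_eq] at hBw hosc
      rw [walk_cons_false_eq, covWalkSum_cons, List.length_cons, sum_netDisp_cons_false_smul]
      have hstep : covStep V X ⟨⟨x.unshift μ, μ⟩, false⟩
          = -(stepFactor V ⟨⟨x.unshift μ, μ⟩, false⟩ * X ⟨x.unshift μ, μ⟩ * star (stepFactor V ⟨⟨x.unshift μ, μ⟩, false⟩)) := by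
        simp only [covStep, Bool.false_eq_true, ↓reduceIte]
      have hsf : stepFactor V ⟨⟨x.unshift μ, μ⟩, false⟩ = (((V ⟨x.unshift μ, μ⟩)⁻¹ : Matrix.specialUnitaryGroup n ℂ) : Matrix n n ℂ) := by
        simp only [stepFactor, Bool.false_eq_true, ↓reduceIte, coe_inv_eq_star]
      rw [hstep, hsf, conj_step_split_bwd]
      -- the frame at `b₋ = x − e_μ` (prefix `p = 1`)
      have hf1 := hframe 1 (by simp)
      have hw0 : walk (x.unshift μ) ([] : List (Letter P.d)) = [] := rfl
      have he0 : walkEnd (x.unshift μ) ([] : List (Letter P.d)) = x.unshift μ := rfl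
      rw [(walk_cons_false_take x μ w 0).1, (walk_cons_false_take x μ w 0).2, List.take_zero, hw0, he0, holAt_cons, holAt_nil,
        mul_one] at hf1
      simp only [Bool.false_eq_true, ↓reduceIte] at hf1
      have h1 := norm_conj_sub_const_le_of_frame X m τ hθ (W * (V ⟨x.unshift μ, μ⟩)⁻¹) ⟨x.unshift μ, μ⟩
        (hBw ⟨⟨x.unshift μ, μ⟩, false⟩ List.mem_cons_self) (hosc ⟨⟨x.unshift μ, μ⟩, false⟩ List.mem_cons_self) hf1
      rw [Submonoid.coe_mul, star_mul] at h1
      -- the tail, transported by `W·V(b)⁻¹`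
      have h2 := ih (x.unshift μ) (W * (V ⟨x.unshift μ, μ⟩)⁻¹)
        (fun s hs => hBw s (List.mem_cons_of_mem _ hs)) (fun s hs => hosc s (List.mem_cons_of_mem _ hs))
        (fun p hp => by
          have h := hframe (p + 1) (Nat.succ_le_succ hp)
          rw [(walk_cons_false_take x μ w p).1, (walk_cons_false_take x μ w p).2, holAt_cons] at h
          simpa only [Bool.false_eq_true, ↓reduceIte, mul_assoc] using h)
      rw [Submonoid.coe_mul, star_mul] at h2
      refine (norm_add_le _ _).trans ?_
      rw [norm_neg]
      push_cast
      linarith [h1, h2]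

/-- **THE COVARIANT COMB MEAN, CENTRED** (covariant twin of `Prop7CombMeanCentred.norm_combMean_le_osc`): for ANY reference frames `τ` on the sites of
`B(z)` and direction constants `m`, if `‖X(b)‖ ≤ B` and `‖τ(b₋)X(b)τ(b₋)* − m_{dir b}‖ ≤ o` on the bonds with both end-points in `B(z)`, and the background's
staircase transports agree with the frames up to `θ` at every visited site, then
`‖|I|⁻¹Σ_i X_V(Γ^{σ_i}_{z→x_i})‖ ≤ (d+2)L·(o + 2θB)` — the frame-read constants sum to `Σ_κ n_κ(r)•m_κ` along the staircase to offset `n(r)`, and the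
centred offsets average to zero (`sum_off_eq_zero`, `L` odd). [cite: Balaban1985Averaging, (62) p.28; Balaban1987RG1, (0.3)-(0.4) pp.252-253] -/
theorem norm_covCombMean_le_osc (hj : j + 1 ≤ P.m + P.K) (V : GaugeField P j (Matrix.specialUnitaryGroup n ℂ)) (X : PBond P j → Matrix n n ℂ)
    (m : Fin P.d → Matrix n n ℂ) (z : Site P (j + 1)) (τ : Site P j → Matrix.specialUnitaryGroup n ℂ) {o θ B : ℝ} (ho : 0 ≤ o) (hθ : 0 ≤ θ) (hB : 0 ≤ B)
    (hBz : ∀ b : PBond P j, blockOf b.src = z → blockOf b.tgt = z → ‖X b‖ ≤ B)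
    (hosc : ∀ b : PBond P j, blockOf b.src = z → blockOf b.tgt = z →
      ‖((τ b.src : Matrix.specialUnitaryGroup n ℂ) : Matrix n n ℂ) * X b * star ((τ b.src : Matrix.specialUnitaryGroup n ℂ) : Matrix n n ℂ) - m b.dir‖ ≤ o)
    (hframe : ∀ (σ : Equiv.Perm (Fin P.d)) (r : Fin P.d → Fin P.L) (p : ℕ), p ≤ (stairWord σ (off r)).length →
      ‖((holAt V (walk (emb z) ((stairWord σ (off r)).take p)) : Matrix.specialUnitaryGroup n ℂ) : Matrix n n ℂ) *
          star ((τ (walkEnd (emb z) ((stairWord σ (off r)).take p)) : Matrix.specialUnitaryGroup n ℂ) : Matrix n n ℂ) - 1‖ ≤ θ) :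
    ‖((Fintype.card (Idx P) : ℂ))⁻¹ • ∑ i : Idx P, covWalkSum V X (walk (emb z) (stairWord i.2.1 (off i.1)))‖
      ≤ ((P.d + 2) * P.L : ℕ) * (o + 2 * θ * B) := by
  -- the frame-read constants of the `i`-th staircase
  set D : Idx P → Matrix n n ℂ := fun i => ∑ κ : Fin P.d, (off i.1 κ) • m κ with hD
  have hD0 : ∑ i : Idx P, D i = 0 := by
    rw [hD, sum_idx_of_fst (fun r => ∑ κ : Fin P.d, (off r κ) • m κ), Finset.sum_comm]
    have h0 : ∀ κ : Fin P.d, ∑ r : Fin P.d → Fin P.L, (off r κ) • m κ = 0 := fun κ => by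
      rw [← Finset.sum_smul, sum_off_eq_zero, zero_smul]
    simp only [h0, Finset.sum_const_zero, smul_zero]
  have hrw : ((Fintype.card (Idx P) : ℂ))⁻¹ • ∑ i : Idx P, covWalkSum V X (walk (emb z) (stairWord i.2.1 (off i.1)))
      = ((Fintype.card (Idx P) : ℂ))⁻¹ • ∑ i : Idx P, (covWalkSum V X (walk (emb z) (stairWord i.2.1 (off i.1))) - D i) := by
    rw [Finset.sum_sub_distrib, hD0, sub_zero]
  rw [hrw]
  have ht : 0 ≤ (((P.d + 2) * P.L : ℕ) : ℝ) * (o + 2 * θ * B) := by positivity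
  refine norm_card_inv_smul_sum_le ht fun i => ?_
  have h := norm_conj_covWalkSum_sub_netDisp_le V X m τ hθ (stairWord i.2.1 (off i.1)) (emb z) 1
    (fun s hs => by have hb := blockOf_of_mem_walk_stairWord hj z i.2.1 i.1 hs; exact hBz s.bond hb.1 hb.2)
    (fun s hs => by have hb := blockOf_of_mem_walk_stairWord hj z i.2.1 i.1 hs; exact hosc s.bond hb.1 hb.2)
    (fun p hp => by rw [one_mul]; exact hframe i.2.1 i.1 p hp)
  simp only [OneMemClass.coe_one, one_mul, star_one, mul_one, netDisp_stairWord] at h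
  refine h.trans (mul_le_mul_of_nonneg_right ?_ (by positivity))
  have hlen := length_walk_stairWord_le (emb z) i.2.1 i.1
  rw [length_walk] at hlen
  exact_mod_cast hlen

end Centring

/-! ## §2 The frame defect of the canonical staircase frame (non-abelian Stokes) -/

section Frame

variable {n : Type*} [Fintype n] [DecidableEq n] [Nonempty n] {j : ℕ}

omit [Fintype n] [DecidableEq n] [Nonempty n] in
/-- Passing a strict small-field bound to the non-strict level (continuity in the threshold). [folklore] -/
private theorem le_mul_of_forall_gt {x κ a : ℝ} (hκ : 0 ≤ κ) (h : ∀ δ, a < δ → x ≤ κ * δ) : x ≤ κ * a := by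
  by_contra hx
  push Not at hx
  rcases eq_or_lt_of_le hκ with hκ0 | hκ0
  · have h1 := h (a + 1) (by linarith)
    rw [← hκ0] at h1 hx
    simp at h1 hx
    exact absurd h1 (not_le.mpr hx)
  · have h1 := h (a + (x - κ * a) / (2 * κ)) (by
      have : 0 < (x - κ * a) / (2 * κ) := div_pos (by linarith) (by linarith)
      linarith)
    have e : κ * (a + (x - κ * a) / (2 * κ)) = κ * a + (x - κ * a) / 2 := by field_simp
    rw [e] at h1
    linarith

omit [Fintype n] [DecidableEq n] [Nonempty n] in
/-- **THE PREFIXES OF A STAIRCASE FROM THE CENTRE STAY INSIDE THE LABEL RANGE**: for `y = walkEnd (emb z) ((stairWord σ (off r)).take p)`, the integer offset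
`y − emb z` (difference of labels) is the net displacement of the prefix — no reduction modulo the period occurs (offsets `|n_κ| ≤ (L−1)/2`, standing range).
[cite: Balaban1987RG1, (0.3) p.252] -/
theorem intOffset_walkEnd_take_stairWord (hj : j + 1 ≤ P.m + P.K) (z : Site P (j + 1)) (σ : Equiv.Perm (Fin P.d)) (r : Fin P.d → Fin P.L)
    (p : ℕ) (κ : Fin P.d) :
    (((walkEnd (emb z) ((stairWord σ (off r)).take p)) κ).val : ℤ) - (((emb z) κ).val : ℤ) = netDisp ((stairWord σ (off r)).take p) κ := by
  set t : ℤ := netDisp ((stairWord σ (off r)).take p) κ with ht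
  set hh : ℕ := (P.L - 1) / 2 with hhh
  have hb := netDisp_take_stairWord σ (off r) κ p
  have hn := off_bounds r κ
  have hL := AveragingRT.two_mul_half_add_one P
  have hlo : 0 ≤ (hh : ℤ) + t := by
    rcases le_total 0 (off r κ) with h0 | h0
    · rw [min_eq_left h0] at hb; omega
    · rw [min_eq_right h0] at hb; omega
  have hhi : (hh : ℤ) + t ≤ (P.L : ℤ) - 1 := by
    rcases le_total 0 (off r κ) with h0 | h0
    · rw [max_eq_right h0] at hb; omega
    · rw [max_eq_left h0] at hb; omega
  obtain ⟨u, hu⟩ : ∃ u : ℕ, (u : ℤ) = (hh : ℤ) + t := ⟨((hh : ℤ) + t).toNat, Int.toNat_of_nonneg hlo⟩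
  have hval_emb : ((emb z) κ).val = (z κ).val * P.L + hh := Site.val_emb hj z κ
  -- the label of `y`
  have hy : (walkEnd (emb z) ((stairWord σ (off r)).take p)) κ = ((((z κ).val * P.L + u : ℕ)) : ZMod (P.sitesPerDir j)) := by
    rw [walkEnd_apply, ← ht]
    have he : (emb z) κ = ((((z κ).val * P.L + hh : ℕ)) : ZMod (P.sitesPerDir j)) := by
      rw [← hval_emb, ZMod.natCast_zmod_val]
    rw [he]
    have htu : t = (u : ℤ) - (hh : ℤ) := by omega
    rw [htu]
    push_cast
    ring
  have hlt : (z κ).val * P.L + u < P.sitesPerDir j := by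
    have hzv : (z κ).val + 1 ≤ P.sitesPerDir (j + 1) := ZMod.val_lt (z κ)
    have h3 : ((z κ).val + 1) * P.L ≤ P.sitesPerDir (j + 1) * P.L := Nat.mul_le_mul_right _ hzv
    rw [P.sitesPerDir_eq_mul_succ hj]
    rw [Nat.add_mul, one_mul] at h3
    omega
  rw [hy, ZMod.val_natCast, Nat.mod_eq_of_lt hlt, hval_emb]
  push_cast
  omega

/-- **THE FRAME DEFECT OF THE CANONICAL STAIRCASE FRAME** (`hframe` of `norm_covCombMean_le_osc` discharged): at a background `V` of `T^{(j)}` whose plaquette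
variables are within `a` of `1`, the transport along any prefix of any staircase `Γ^σ_{z→x(r)}` agrees with the canonical frame
`τ_z(y) = V(Γ^{1}_{z→y})` (the `σ = 1` staircase to the integer offset `y − emb z`) up to `((dL)²/4)·a`: the two paths form a closed lattice word of length
`≤ d(L−1)`, bounded by the tree's non-abelian Stokes estimate `LatticeWordStokes.dist1_holAt_le`. [cite: Balaban1985Averaging, (19)-(20) p.21; Balaban1987RG1, (0.3) p.252] -/
theorem frame_defect_stair_le (hj : j + 1 ≤ P.m + P.K) (V : GaugeField P j (Matrix.specialUnitaryGroup n ℂ)) {a : ℝ} (ha : 0 ≤ a)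
    (hV : ∀ q : Plaq P j, dist1 (GaugeField.plaqHol V q) ≤ a) (z : Site P (j + 1)) (σ : Equiv.Perm (Fin P.d)) (r : Fin P.d → Fin P.L) (p : ℕ) :
    ‖((holAt V (walk (emb z) ((stairWord σ (off r)).take p)) : Matrix.specialUnitaryGroup n ℂ) : Matrix n n ℂ) *
        star (((fun y : Site P j => holAt V (walk (emb z) (stairWord 1 fun κ => ((y κ).val : ℤ) - (((emb z) κ).val : ℤ))))
          (walkEnd (emb z) ((stairWord σ (off r)).take p)) : Matrix.specialUnitaryGroup n ℂ) : Matrix n n ℂ) - 1‖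
      ≤ ((((P.d * P.L : ℕ) : ℝ)) ^ 2 / 4) * a := by
  set w₁ : List (Letter P.d) := (stairWord σ (off r)).take p with hw₁
  set nv : Fin P.d → ℤ := netDisp w₁ with hnv
  -- the canonical frame at the prefix's end is the `σ = 1` staircase to the prefix's net displacement
  have hoff : (fun κ => (((walkEnd (emb z) w₁) κ).val : ℤ) - (((emb z) κ).val : ℤ)) = nv := by
    funext κ; exact intOffset_walkEnd_take_stairWord hj z σ r p κ
  simp only [hoff]
  -- the `σ = 1` staircase ends at the same site; its reverse closes the loop
  have hend : walkEnd (emb z) (stairWord 1 nv) = walkEnd (emb z) w₁ := by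
    funext κ; rw [walkEnd_apply, walkEnd_apply, netDisp_stairWord]
  have hinv : ((holAt V (walk (emb z) (stairWord 1 nv)))⁻¹ : Matrix.specialUnitaryGroup n ℂ)
      = holAt V (walk (walkEnd (emb z) w₁) (wordRev (stairWord 1 nv))) := by
    rw [← hend, holAt_walk_wordRev]
  have hprod : ((holAt V (walk (emb z) w₁) : Matrix.specialUnitaryGroup n ℂ) : Matrix n n ℂ) *
        star ((holAt V (walk (emb z) (stairWord 1 nv)) : Matrix.specialUnitaryGroup n ℂ) : Matrix n n ℂ)
      = ((holAt V (walk (emb z) (w₁ ++ wordRev (stairWord 1 nv))) : Matrix.specialUnitaryGroup n ℂ) : Matrix n n ℂ) := by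
    rw [walk_append, holAt_append, Submonoid.coe_mul, ← hinv]
    rfl
  rw [hprod, ← FederbushMean.dist1_SU_eq]
  -- the loop is closed and short
  have hclosed : ∀ ν, netDisp (w₁ ++ wordRev (stairWord 1 nv)) ν = 0 := fun ν => by
    rw [T4ReflectionCone.netDisp_append, netDisp_wordRev, netDisp_stairWord, hnv, add_neg_cancel]
  have hhL : 2 * ((P.L - 1) / 2) + 1 = P.L := AveragingRT.two_mul_half_add_one P
  have hN1 : ∀ ν, (off r ν).natAbs ≤ (P.L - 1) / 2 := fun ν => by have h := off_bounds r ν; omega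
  have hN2 : ∀ ν, (nv ν).natAbs ≤ (P.L - 1) / 2 := fun ν => by
    have hb := netDisp_take_stairWord σ (off r) ν p
    have hn := off_bounds r ν
    rw [hnv, hw₁]
    rcases le_total 0 (off r ν) with h0 | h0
    · rw [min_eq_left h0, max_eq_right h0] at hb; omega
    · rw [min_eq_right h0, max_eq_left h0] at hb; omega
  have hlen : ((w₁ ++ wordRev (stairWord 1 nv)).length : ℝ) ≤ ((P.d * P.L : ℕ) : ℝ) := by
    have h1 : w₁.length ≤ P.d * ((P.L - 1) / 2) := by
      rw [hw₁, List.length_take]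
      exact (min_le_right _ _).trans (LatticeWordStokes.length_stairWord_le σ (off r) _ hN1)
    have h2 : (wordRev (stairWord 1 nv)).length ≤ P.d * ((P.L - 1) / 2) := by
      have : (wordRev (stairWord 1 nv)).length = (stairWord 1 nv).length := by simp [wordRev]
      rw [this]
      exact LatticeWordStokes.length_stairWord_le 1 nv _ hN2
    have h3 : (w₁ ++ wordRev (stairWord 1 nv)).length ≤ P.d * P.L := by
      rw [List.length_append]
      calc w₁.length + (wordRev (stairWord 1 nv)).length ≤ P.d * ((P.L - 1) / 2) + P.d * ((P.L - 1) / 2) := add_le_add h1 h2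
        _ = P.d * (2 * ((P.L - 1) / 2)) := by ring
        _ ≤ P.d * P.L := Nat.mul_le_mul_left _ (by omega)
    exact_mod_cast h3
  refine le_mul_of_forall_gt (by positivity) fun δ hδ => ?_
  have hδ0 : 0 ≤ δ := ha.trans hδ.le
  have h := LatticeWordStokes.dist1_holAt_le V hδ0 (fun q => (hV q).trans_lt hδ) _ hclosed (emb z)
  refine h.trans (mul_le_mul_of_nonneg_right ?_ hδ0)
  have h0 : (0 : ℝ) ≤ ((w₁ ++ wordRev (stairWord 1 nv)).length : ℝ) := Nat.cast_nonneg _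
  have := mul_le_mul hlen hlen h0 (by positivity)
  nlinarith

end Frame


end Summit.QuantumFields.YangMills.Theorems.Prop7CovCombMeanCentred

end
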